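import Literature.NumberTheory.Transcendental.RoySmallValueMain

/-!
# Route `RoyCriterion`, crux `RoySmallValueDirichletGap` (stmt-Schanuel-1050), line
# `two-sided-absorption-transfer` — helper for the stub `StubEnemyOrbits`: Step 2 at one level

Roy 2013, §7, Step 2 at ONE level `D`, re-run verbatim from the tree's proof of Roy's Theorem 1.1
(`Literature.NumberTheory.Transcendental.Roy2013.roy2013_thm_1_1_holds`, Step 2), but with its
output EXPOSED instead of consumed: for a level package `L` of an integer form `P̃` of degree `D`
whose complexification and companion `Q` lie in Roy's body `𝒞_D = royBody D ξ η (3D^β) (D^ν/4) T`,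
`T = ⌊D^τ⌋`, over a normal number field `K` containing the coordinates, and under the level-`D`
thresholds of `RoySmallValueThresholds` / `RoySmallValueGammaBound` (hypotheses `h36 … hE2`, all of
the form "`D` is large"), there is an orbit `O = orb j₀` of the configuration `L.cfg K hK` with

1. (vanishing) every `R ∈ ℤ[X]_D` with `R ⊗ ℂ ∈ 𝒞_D` vanishes on `O`;
2. (mass) `∑_{j ∈ O ∩ 𝒰} max{T log dist(u_j,(1:γ)), log dist(u_j, A_γ)} ≤ −κ D^δ (D^β #O + D h(O))`,
   `κ = 1/1280`, `δ = ν + τ − 2 − β`, `h(O) = ∑_{j∈O} h_K(rep j)/[K:ℚ]`;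
3. (chart) `u_{j,0} ≠ 0 ≠ u_{j,2}` on `O`;
4. (the point `α₀`) some `j₁ ∈ O ∩ 𝒰` has `dist(u_{j₁},(1:γ)) ≤ exp(−κ D^{ν−2})`.

No lower bound on `ν` beyond `ν > 2` is used (this is the point of the stub). No definitions.

## References

* [Roy2013] D. Roy, *A small value estimate for 𝔾ₐ × 𝔾ₘ*, Mathematika 59 (2013), 333–363
  (arXiv:1301.0663), §7, Step 2.
-/

-- `Summit.Schanuel.Schanuel.…` is the mandated layout of this single-problem summit (CONVENTIONS §1).
set_option linter.dupNamespace false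

noncomputable section

namespace Summit.Schanuel.Schanuel.Theorems.RoyLinks

open Filter MvPolynomial Finset Height
open Literature.NumberTheory.Transcendental
open Literature.NumberTheory.Transcendental.Roy2013
open Literature.NumberTheory.Transcendental.Nesterenko

/-- **Roy 2013, §7, Step 2 at one level `D`, exposed** (see the module docstring): the orbit
`O = orb j₀`, the vanishing of the integer forms of `𝒞_D` on `O`, the mass inequality
`∑_{O∩𝒰} max{T log d₁, log d₂} ≤ −κ D^δ (D^β #O + D h(O))`, the chart `u₀u₂ ≠ 0` on `O`, and the
close point `α₀ = u_{j₁}`. Verbatim the Step-2 block of the tree's `roy2013_thm_1_1_holds`.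
[cite: Roy2013, §7, Step 2] -/
theorem level_step2 {ξ η : ℂ} (hη : η ≠ 0) (hna : ¬(IsAlgebraic ℚ ξ ∧ IsAlgebraic ℚ η))
    {β τ ν δ κ : ℝ} (hτ1 : 1 ≤ τ) (hτ2 : τ < 2) (hδdef : δ = ν + τ - 2 - β) (hκ : κ = 1 / 1280)
    {D : ℕ} (h5 : 5 ≤ D) {Pt : MvPolynomial (Fin 3) ℤ} (L : LevelPkg D Pt)
    (hPth : (map (Int.castRingHom ℂ) Pt).IsHomogeneous D) (hPt0 : map (Int.castRingHom ℂ) Pt ≠ 0)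
    (K : IntermediateField ℚ ℂ) [Normal ℚ K] [NumberField K] (hK : ∀ i kk, L.α i kk ∈ K)
    {T : ℕ} (hT : ⌊(D : ℝ) ^ τ⌋₊ = T)
    (hPmemD : map (Int.castRingHom ℂ) Pt ∈ royBody D ξ η (3 * (D : ℝ) ^ β) ((D : ℝ) ^ ν / 4) T)
    (hQmemD : map (Int.castRingHom ℂ) (levelQ D Pt L.t) ∈
      royBody D ξ η (3 * (D : ℝ) ^ β) ((D : ℝ) ^ ν / 4) T)
    (h36 : 36 * ⌊(D : ℝ) ^ τ⌋₊ ≤ D ^ 2) (hsq : D ^ 2 < 2 ^ D)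
    (hNN : ((3 * D + 2).choose 2 : ℝ) * Real.log ((3 * D + 2).choose 2 : ℝ) ≤ 7 * (D : ℝ) ^ (2 + β))
    (hle : 4 * Real.log 2 * (D : ℝ) ^ 3 +
        ((3 * D + 2).choose 2 : ℝ) * Real.log ((3 * D + 2).choose 2 : ℝ) +
        ((3 * D + 2).choose 2 : ℝ) * (Real.log 3 + 3 * (D : ℝ) ^ β) + 3 * (D : ℝ) ^ β * (D : ℝ) ^ 2 ≤
      ⌊(D : ℝ) ^ τ⌋₊ * ((D : ℝ) ^ ν / 4) / 2)
    (hI : (3 * (1 + ‖ξ‖ + ‖η‖⁻¹)) ^ ⌊(D : ℝ) ^ τ⌋₊ *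
        (4 * ((⌊(D : ℝ) ^ τ⌋₊ : ℝ) + 1)) ^ (3 * ⌊(D : ℝ) ^ τ⌋₊) ≤ Real.exp (3 * (D : ℝ) ^ β))
    (hΓ : ∀ T k : ℕ, 1 ≤ T → (T : ℝ) ≤ (D : ℝ) ^ τ → (k : ℝ) ≤ 1 + 3 * Real.log D →
      max ((max (Real.log (2 ^ T * (3 * (3 * (1 + ‖ξ‖ + ‖η‖⁻¹) * max 1 (max ‖ξ‖ ‖η‖)) ^ T *
              (16 * (T : ℝ) ^ 3) ^ T) ^ k))
            (Real.log (2 * ((2 * roy_c2 ξ η) ^ T * (1 + roy_c2 ξ η * Real.exp (1 + roy_c2 ξ η)) *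
              (3 * (3 * (1 + ‖ξ‖ + ‖η‖⁻¹) * max 1 (max ‖ξ‖ ‖η‖)) ^ T *
                (16 * (T : ℝ) ^ 3) ^ T) ^ k))) +
          |Real.log (2 * (roy_c2 ξ η * Real.exp (roy_c2 ξ η) * (2 * roy_c2 ξ η ^ 2) ^ T))|))
          (Real.log (2 ^ T * (3 * (3 * (1 + ‖ξ‖ + ‖η‖⁻¹) * max 1 (max ‖ξ‖ ‖η‖)) ^ T *
              (16 * (T : ℝ) ^ 3) ^ T) ^ k) - T * Real.log ((2 * roy_c2 ξ η)⁻¹)) ≤ (D : ℝ) ^ β)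
    (hE2 : Real.exp (-(κ * (D : ℝ) ^ (ν - 2))) < ‖η‖ / (2 * roy_c2 ξ η ^ 2)) :
    ∃ j₀ : Fin L.m,
      (∀ R : MvPolynomial (Fin 3) ℤ, R.IsHomogeneous D →
        map (Int.castRingHom ℂ) R ∈ royBody D ξ η (3 * (D : ℝ) ^ β) ((D : ℝ) ^ ν / 4) T →
          ∀ j ∈ (L.cfg K hK).orb j₀, aeval (L.α j) (map (Int.castRingHom ℂ) R) = 0) ∧
      (∑ j ∈ ((L.cfg K hK).orb j₀).filter
          (fun j => pdist ξ η (supNormalise (L.α j)) ≤ (2 * roy_c2 ξ η)⁻¹),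
          max (T * Real.log (pdist ξ η (supNormalise (L.α j))))
            (if 0 < adist ξ η (supNormalise (L.α j)) then Real.log (adist ξ η (supNormalise (L.α j)))
              else T * Real.log (pdist ξ η (supNormalise (L.α j)))) ≤
        -(κ * (D : ℝ) ^ δ * ((D : ℝ) ^ β * ((L.cfg K hK).orb j₀).card +
          D * ((∑ j ∈ (L.cfg K hK).orb j₀, logHeight ((L.cfg K hK).rep j)) /
            Module.finrank ℚ K)))) ∧
      (∀ j ∈ (L.cfg K hK).orb j₀, L.α j 0 ≠ 0 ∧ L.α j 2 ≠ 0) ∧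
      ∃ j₁ ∈ (L.cfg K hK).orb j₀, pdist ξ η (supNormalise (L.α j₁)) ≤ (2 * roy_c2 ξ η)⁻¹ ∧
        pdist ξ η (supNormalise (L.α j₁)) ≤ Real.exp (-(κ * (D : ℝ) ^ (ν - 2))) := by
  classical
  /- exponents, constants, the level -/
  have hτ0 : 0 < τ := by linarith
  have hκ0 : 0 < κ := by rw [hκ]; norm_num
  have hcI : (1 : ℝ) ≤ 3 * (1 + ‖ξ‖ + ‖η‖⁻¹) := by
    have : 0 ≤ ‖ξ‖ := norm_nonneg _; have : 0 ≤ ‖η‖⁻¹ := inv_nonneg.mpr (norm_nonneg _); linarith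
  have h1D : 1 ≤ D := le_trans (by norm_num) h5
  have hx : (0 : ℝ) < D := by exact_mod_cast h1D
  have hx1 : (1 : ℝ) ≤ D := by exact_mod_cast h1D
  -- the parameter `T = ⌊D^τ⌋`
  have hTD : D ≤ T := by rw [← hT]; exact self_le_natFloor_rpow hτ1 D
  have hT1' : 1 ≤ T := le_trans h1D hTD
  have hTτ : (T : ℝ) ≤ (D : ℝ) ^ τ := by rw [← hT]; exact natFloor_rpow_le D τ
  have hT2 : (D : ℝ) ^ τ ≤ 2 * T := by rw [← hT]; exact rpow_le_two_mul_natFloor h1D hτ0.le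
  have hTpos : (0 : ℝ) < T := by exact_mod_cast hT1'
  rw [hT] at h36 hle hI
  -- abbreviations `Y`, `U`
  obtain ⟨Y, hY⟩ : ∃ Y : ℝ, Y = 3 * (D : ℝ) ^ β := ⟨_, rfl⟩
  obtain ⟨U, hU⟩ : ∃ U : ℝ, U = (D : ℝ) ^ ν / 4 := ⟨_, rfl⟩
  have hY0 : 0 < Y := by rw [hY]; positivity
  have hU0 : 0 ≤ U := by rw [hU]; positivity
  rw [← hY, ← hU] at hQmemD hPmemD
  -- the window `Li`, the ratio `kr`, the exponent `k`
  obtain ⟨Li, hLi1, hLi2⟩ := exists_choose_window hT1'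
  have h3L : 3 * (Li + 1) ≤ D := three_mul_window_succ_le hLi1 h36
  obtain ⟨kr, hkr, hkrle⟩ := exists_ratio_k h1D hTD
  have hkex : ∃ k : ℕ, D ^ 2 ≤ 2 ^ k := ⟨D, hsq.le⟩
  obtain ⟨k, hk⟩ : ∃ k : ℕ, k = Nat.find hkex := ⟨_, rfl⟩
  have hkspec : D ^ 2 ≤ 2 ^ k := by rw [hk]; exact Nat.find_spec hkex
  have hkD : k ≤ D := by rw [hk]; exact Nat.find_min' hkex hsq.le
  have h2k : 2 ^ k ≤ 2 * D ^ 2 := by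
    rcases Nat.eq_zero_or_pos k with hk0 | hkpos
    · rw [hk0, pow_zero]; nlinarith only [h1D]
    · have hmin : ¬(D ^ 2 ≤ 2 ^ (k - 1)) := by
        rw [hk] at hkpos ⊢; exact Nat.find_min hkex (Nat.sub_one_lt_of_lt hkpos)
      push Not at hmin
      have : 2 ^ k = 2 * 2 ^ (k - 1) := by rw [← pow_succ']; congr 1; omega
      omega
  -- the bound `B`
  obtain ⟨B, hB⟩ : ∃ B : ℝ, B = 40 * (D : ℝ) ^ (2 + β) := ⟨_, rfl⟩
  have hB0 : 0 < B := by rw [hB]; positivity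
  have hp2b : (D : ℝ) ^ (2 + β) = (D : ℝ) ^ 2 * (D : ℝ) ^ β := by
    rw [Real.rpow_add hx, Real.rpow_two]
  -- opaque names for the three cardinalities
  obtain ⟨N, hN⟩ : ∃ N : ℕ, N = Fintype.card (PhiRow D) := ⟨_, rfl⟩
  obtain ⟨N₀, hN₀⟩ : ∃ N₀ : ℕ, N₀ = Fintype.card ↥(finsuppAntidiag (univ : Finset (Fin 3)) (2 * D)) :=
    ⟨_, rfl⟩
  obtain ⟨N₁, hN₁⟩ : ∃ N₁ : ℕ, N₁ = Fintype.card ↥L.M₁ := ⟨_, rfl⟩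
  have hNeq : N = (3 * D + 2).choose 2 := by rw [hN, LevelPkg.card_phiRow]
  have hN₀eq : N₀ = (2 * D + 2).choose 2 := by rw [hN₀, LevelPkg.card_antidiag_two]
  have hN₁le : N₁ ≤ (2 * D + 2).choose 2 := by rw [hN₁]; exact L.card_M₁_le
  have hNr : (N : ℝ) = ((3 * D + 2).choose 2 : ℝ) := by rw [hNeq]
  have h52 : 2 ≤ D := le_trans (by norm_num) h5
  have hN₀r : (N₀ : ℝ) ≤ 5 * (D : ℝ) ^ 2 := by rw [hN₀eq]; exact choose_two_le h52
  have hN₁r : (N₁ : ℝ) ≤ 5 * (D : ℝ) ^ 2 :=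
    le_trans (by exact_mod_cast hN₁le) (choose_two_le h52)
  have hNlog : Real.log (N.factorial : ℝ) ≤ 7 * ((D : ℝ) ^ 2 * (D : ℝ) ^ β) := by
    have hf := LevelPkg.log_factorial_le N
    rw [hp2b, ← hNr] at hNN
    linarith only [hf, hNN]
  have hBle : Y * D ^ 2 + (∑ i, (L.e i : ℝ) * (D * logHeight ((L.cfg K hK).rep i))) /
      Module.finrank ℚ K ≤ B := by
    have h1 := L.sum_e_mul_height_le' K hK (MP := Real.exp Y) (MQ := Real.exp Y)
      (Real.one_le_exp hY0.le) (Real.one_le_exp hY0.le) hPmemD.2.1 hQmemD.2.1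
    rw [← hN, ← hN₀, ← hN₁, Real.log_exp] at h1
    have hn : (0 : ℝ) < Module.finrank ℚ K := by exact_mod_cast Module.finrank_pos
    have hcards : Real.log (N.factorial : ℝ) + N₀ * Y + N₁ * Y ≤ 37 * ((D : ℝ) ^ 2 * (D : ℝ) ^ β) := by
      rw [hY]
      have hβ' : 0 ≤ (D : ℝ) ^ β := Real.rpow_nonneg hx.le _
      have h3β : (0 : ℝ) ≤ 3 * (D : ℝ) ^ β := by positivity
      have e1 := mul_le_mul_of_nonneg_right hN₀r h3β
      have e2 := mul_le_mul_of_nonneg_right hN₁r h3β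
      linarith only [hNlog, e1, e2]
    have h2 : (∑ i, (L.e i : ℝ) * (D * logHeight ((L.cfg K hK).rep i))) /
        Module.finrank ℚ K ≤ 37 * ((D : ℝ) ^ 2 * (D : ℝ) ^ β) := by
      rw [div_le_iff₀ hn]
      calc (∑ i, (L.e i : ℝ) * (D * logHeight ((L.cfg K hK).rep i)))
          ≤ _ := h1
        _ ≤ Module.finrank ℚ K * (37 * ((D : ℝ) ^ 2 * (D : ℝ) ^ β)) :=
            mul_le_mul_of_nonneg_left hcards hn.le
        _ = 37 * ((D : ℝ) ^ 2 * (D : ℝ) ^ β) * Module.finrank ℚ K := by ring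
    rw [hB, hp2b]
    have h3 : Y * (D : ℝ) ^ 2 = 3 * ((D : ℝ) ^ 2 * (D : ℝ) ^ β) := by rw [hY]; ring
    linarith only [h2, h3]
  -- `ε < 1`, and `log ε ≤ −TU/2`
  obtain ⟨ε, hεdef⟩ : ∃ ε : ℝ, ε = 2 ^ (2 * k * 2 ^ k) * (Real.exp (-(T * U)) *
      ((Fintype.card (PhiRow D)).factorial * (3 * Real.exp Y) ^ Fintype.card (PhiRow D))) *
        Real.exp (Y * D ^ 2) := ⟨_, rfl⟩
  have hεN : ε = 2 ^ (2 * k * 2 ^ k) * (Real.exp (-(T * U)) * (N.factorial * (3 * Real.exp Y) ^ N)) *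
      Real.exp (Y * D ^ 2) := by rw [hεdef, ← hN]
  have hε0 : 0 < ε := by rw [hεN]; positivity
  have hlogε : Real.log ε ≤ -(T * U) / 2 := by
    have hfpos : (0 : ℝ) < N.factorial := by exact_mod_cast Nat.factorial_pos N
    rw [hεN, Real.log_mul (by positivity) (by positivity), Real.log_mul (by positivity) (by positivity),
      Real.log_mul (by positivity) (by positivity), Real.log_mul (by positivity) (by positivity),
      Real.log_pow, Real.log_pow, Real.log_exp, Real.log_exp, Real.log_mul (by norm_num) (by positivity),
      Real.log_exp]
    rw [← hNr] at hle
    have hf := LevelPkg.log_factorial_le N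
    have hkk : ((2 * k * 2 ^ k : ℕ) : ℝ) ≤ 4 * (D : ℝ) ^ 3 := by
      have : 2 * k * 2 ^ k ≤ 4 * D ^ 3 := by
        calc 2 * k * 2 ^ k ≤ 2 * D * (2 * D ^ 2) := Nat.mul_le_mul (Nat.mul_le_mul_left 2 hkD) h2k
          _ = 4 * D ^ 3 := by ring
      exact_mod_cast this
    have hl2 : 0 ≤ Real.log 2 := Real.log_nonneg (by norm_num)
    have hNpos : (0 : ℝ) ≤ N := Nat.cast_nonneg _
    rw [hY, hU]
    have e1 := mul_le_mul_of_nonneg_right hkk hl2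
    linarith only [e1, hle, hf]
  have hε1 : ε < 1 := by
    have hlt : Real.log ε < 0 := by
      have hTU0 : 0 < (T : ℝ) * U := by rw [hU]; positivity
      linarith only [hlogε, hTU0]
    exact (Real.log_neg_iff hε0).mp hlt
  -- the interpolation constant
  have hYI : (3 * (1 + ‖ξ‖ + ‖η‖⁻¹)) ^ Li * (4 * (Li + 1) : ℝ) ^ (Li + 2).choose 2 ≤ Real.exp Y := by
    have hLiT : Li ≤ T := window_le hLi1
    have hch : (Li + 2).choose 2 ≤ 3 * T := choose_window_le hLi1
    have hI' : (3 * (1 + ‖ξ‖ + ‖η‖⁻¹)) ^ T * (4 * ((T : ℝ) + 1)) ^ (3 * T) ≤ Real.exp Y := by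
      rw [hY]; exact hI
    refine le_trans ?_ hI'
    have h1 : (3 * (1 + ‖ξ‖ + ‖η‖⁻¹)) ^ Li ≤ (3 * (1 + ‖ξ‖ + ‖η‖⁻¹)) ^ T := pow_le_pow_right₀ hcI hLiT
    have hb1 : (1 : ℝ) ≤ 4 * ((Li : ℝ) + 1) := by
      have h0 : (0 : ℝ) ≤ Li := Nat.cast_nonneg _; linarith only [h0]
    have h2 : (4 * ((Li : ℝ) + 1)) ^ (Li + 2).choose 2 ≤ (4 * ((T : ℝ) + 1)) ^ (3 * T) :=
      (pow_le_pow_right₀ hb1 hch).trans (pow_le_pow_left₀ (by positivity) (by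
        have hLr : (Li : ℝ) ≤ T := by exact_mod_cast hLiT
        linarith only [hLr]) _)
    exact mul_le_mul h1 h2 (by positivity) (by positivity)
  -- Step 2
  obtain ⟨j₀, hvanO, hdistO⟩ := L.step2_level hPth hPt0 hη hna hLi1 hLi2 h3L hTD hkr
    hY0 hU0 hYI hPmemD hQmemD hkspec K hK hB0 hBle (by rw [← hεdef]; exact hε1)
  rw [← hεdef] at hdistO
  obtain ⟨O, hOdef⟩ : ∃ O : Finset (Fin L.m), O = (L.cfg K hK).orb j₀ := ⟨_, rfl⟩
  obtain ⟨hO, hhO⟩ : ∃ hO : ℝ, hO = (∑ j ∈ O, logHeight ((L.cfg K hK).rep j)) /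
      Module.finrank ℚ K := ⟨_, rfl⟩
  have hn0 : (0 : ℝ) < Module.finrank ℚ K := by exact_mod_cast Module.finrank_pos
  have hhO0 : 0 ≤ hO := by
    rw [hhO]; exact div_nonneg (sum_nonneg fun j _ => logHeight_nonneg _) hn0.le
  obtain ⟨d, hd⟩ : ∃ d : ℝ, d = O.card := ⟨_, rfl⟩
  have hOne : O.Nonempty := by rw [hOdef]; exact ⟨j₀, (L.cfg K hK).self_mem_orb j₀⟩
  have hd1 : 1 ≤ d := by rw [hd]; exact_mod_cast hOne.card_pos
  -- the distance sum: `≤ −Λ₂`, `Λ₂ = κ D^δ (D^β d + D hO)`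
  obtain ⟨Λ₂, hΛ₂⟩ : ∃ Λ₂ : ℝ, Λ₂ = κ * (D : ℝ) ^ δ * ((D : ℝ) ^ β * d + D * hO) := ⟨_, rfl⟩
  have hdist2 : ∑ j ∈ O.filter (fun j => pdist ξ η (supNormalise (L.α j)) ≤ (2 * roy_c2 ξ η)⁻¹),
      max (T * Real.log (pdist ξ η (supNormalise (L.α j))))
        (if 0 < adist ξ η (supNormalise (L.α j)) then Real.log (adist ξ η (supNormalise (L.α j)))
          else T * Real.log (pdist ξ η (supNormalise (L.α j)))) ≤ -Λ₂ := by
    rw [hOdef]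
    refine hdistO.trans ?_
    rw [← hOdef]
    -- `Γ'' ≤ D^β ≤ Y/3`
    have hkr3 : (kr : ℝ) ≤ 1 + 3 * Real.log D := by
      refine hkrle.trans ?_
      have hlog : Real.log ((T : ℝ) / D) ≤ Real.log D := by
        have h1 : (T : ℝ) / D ≤ (D : ℝ) ^ τ / D := div_le_div_of_nonneg_right hTτ hx.le
        have h2 : (D : ℝ) ^ τ / D = (D : ℝ) ^ (τ - 1) := by
          rw [Real.rpow_sub hx, Real.rpow_one]
        have h3 : (D : ℝ) ^ (τ - 1) ≤ (D : ℝ) ^ (1 : ℝ) :=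
          Real.rpow_le_rpow_of_exponent_le hx1 (by linarith only [hτ2])
        rw [Real.rpow_one] at h3
        calc Real.log ((T : ℝ) / D) ≤ Real.log ((D : ℝ) ^ (τ - 1)) :=
              Real.log_le_log (div_pos hTpos hx) (by rw [← h2]; exact h1)
          _ ≤ Real.log D := Real.log_le_log (Real.rpow_pos_of_pos hx _) h3
      have hlog0 : 0 ≤ Real.log D := Real.log_nonneg hx1
      have hl32 : 0 < Real.log (3 / 2) := Real.log_pos (by norm_num)
      have h4 : Real.log ((T : ℝ) / D) / Real.log (3 / 2) ≤ Real.log D / Real.log (3 / 2) :=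
        div_le_div_of_nonneg_right hlog hl32.le
      have h5' : Real.log D / Real.log (3 / 2) ≤ Real.log D * 3 := by
        rw [div_eq_mul_inv]; exact mul_le_mul_of_nonneg_left inv_log_three_halves_le hlog0
      linarith only [h4, h5']
    have hΓle := hΓ T kr hT1' hTτ hkr3
    -- `(w/B) log ε ≤ (w/B)(−TU/2)` and `TU/2 ≥ D^{τ+ν}/16`
    have hTU : (D : ℝ) ^ τ * (D : ℝ) ^ ν / 16 ≤ T * U / 2 := by
      rw [hU]
      have hν0 := Real.rpow_nonneg hx.le ν
      calc (D : ℝ) ^ τ * (D : ℝ) ^ ν / 16 ≤ (2 * T) * (D : ℝ) ^ ν / 16 :=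
            div_le_div_of_nonneg_right (mul_le_mul_of_nonneg_right hT2 hν0) (by norm_num)
        _ = T * ((D : ℝ) ^ ν / 4) / 2 := by ring
    have hδpow : (D : ℝ) ^ δ * (D : ℝ) ^ (2 + β) = (D : ℝ) ^ τ * (D : ℝ) ^ ν := by
      rw [← Real.rpow_add hx, ← Real.rpow_add hx]; congr 1; rw [hδdef]; ring
    have hwB : ∀ w : ℝ, 0 ≤ w → w / B * Real.log ε ≤ -(w * (D : ℝ) ^ δ / 1280) := by
      intro w hw
      have h1 : w / B * Real.log ε ≤ w / B * (-(T * U) / 2) :=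
        mul_le_mul_of_nonneg_left hlogε (div_nonneg hw hB0.le)
      refine h1.trans ?_
      rw [hB]
      have hp : 0 < (D : ℝ) ^ (2 + β) := Real.rpow_pos_of_pos hx _
      rw [div_mul_eq_mul_div, div_le_iff₀ (by positivity)]
      have hTU0 : 0 ≤ w * (T * U / 2) := mul_nonneg hw (by positivity)
      have e := mul_le_mul_of_nonneg_left hTU hw
      have h2 : w * ((D : ℝ) ^ δ * (D : ℝ) ^ (2 + β)) / 32 ≤ w * (T * U / 2) := by
        rw [hδpow]; linarith only [e, hTU0]
      linarith only [h2]
    -- rename `#O ↦ d`, `Σ h / n ↦ hO`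
    rw [← hd]
    have hw_eq : Y * d + (D : ℝ) * (∑ j ∈ O, logHeight ((L.cfg K hK).rep j)) /
        (Module.finrank ℚ K : ℝ) = Y * d + D * hO := by rw [hhO, mul_div_assoc]
    rw [hw_eq]
    have hw0' : 0 ≤ Y * d + D * hO := by
      have := hd1; positivity
    have hwO := hwB _ hw0'
    have hd0 : (0 : ℝ) ≤ d := by linarith only [hd1]
    have hβ0' : (0 : ℝ) ≤ (D : ℝ) ^ β := Real.rpow_nonneg hx.le β
    have hδ0' : (0 : ℝ) ≤ (D : ℝ) ^ δ := Real.rpow_nonneg hx.le δ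
    have hΓO := mul_le_mul_of_nonneg_right hΓle hd0
    have hwge : (D : ℝ) ^ β * d + D * hO ≤ Y * d + D * hO := by
      rw [hY]; have := mul_nonneg hβ0' hd0; linarith only [this]
    have hprod := mul_le_mul_of_nonneg_right hwge (by positivity : (0 : ℝ) ≤ (D : ℝ) ^ δ / 1280)
    have hYd : (D : ℝ) ^ β * d ≤ Y * d := by
      rw [hY]; have := mul_nonneg hβ0' hd0; linarith only [this]
    have hβd0 : 0 ≤ (D : ℝ) ^ β * d := mul_nonneg hβ0' hd0
    rw [hΛ₂, hκ]
    linarith only [hwO, hΓO, hprod, hYd, hβd0, hw0']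
  have hΛ₂ge : κ * (D : ℝ) ^ (δ + β) * d ≤ Λ₂ := by
    rw [hΛ₂, Real.rpow_add hx]
    have e : 0 ≤ κ * (D : ℝ) ^ δ * (D * hO) :=
      mul_nonneg (mul_nonneg hκ0.le (Real.rpow_nonneg hx.le δ)) (mul_nonneg hx.le hhO0)
    linarith only [e]
  -- the point `α₀ = u_{j₁}` close to `(1:γ)`
  have hMpos : 0 < κ * (D : ℝ) ^ (δ + β) := mul_pos hκ0 (Real.rpow_pos_of_pos hx _)
  have hsumU : ∑ j ∈ O.filter (fun j => pdist ξ η (supNormalise (L.α j)) ≤ (2 * roy_c2 ξ η)⁻¹),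
      max (T * Real.log (pdist ξ η (supNormalise (L.α j))))
        (if 0 < adist ξ η (supNormalise (L.α j)) then Real.log (adist ξ η (supNormalise (L.α j)))
          else T * Real.log (pdist ξ η (supNormalise (L.α j)))) ≤ -(κ * (D : ℝ) ^ (δ + β) * d) :=
    hdist2.trans (by linarith only [hΛ₂ge])
  obtain ⟨j₁, hj₁O, hj₁near, hj₁le⟩ := exists_close_point_of_sum_le O
    (fun j => pdist ξ η (supNormalise (L.α j)) ≤ (2 * roy_c2 ξ η)⁻¹)
    (fun j => (T : ℝ) * Real.log (pdist ξ η (supNormalise (L.α j))))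
    (fun j => if 0 < adist ξ η (supNormalise (L.α j)) then Real.log (adist ξ η (supNormalise (L.α j)))
      else T * Real.log (pdist ξ η (supNormalise (L.α j))))
    hMpos (by linarith only [hd1]) (by rw [hd]) hsumU
  have hd₁pos : ∀ j, 0 < pdist ξ η (supNormalise (L.α j)) := fun j =>
    L.pdist_supNormalise_pos hPth hPt0 hna j
  have hsmall : pdist ξ η (supNormalise (L.α j₁)) ≤ Real.exp (-(κ * (D : ℝ) ^ (ν - 2))) := by
    have h1 : (T : ℝ) * Real.log (pdist ξ η (supNormalise (L.α j₁))) ≤ -(κ * (D : ℝ) ^ (δ + β)) :=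
      hj₁le
    have h2 : Real.log (pdist ξ η (supNormalise (L.α j₁))) ≤ -(κ * (D : ℝ) ^ (ν - 2)) := by
      rw [← le_div_iff₀' hTpos] at h1
      refine h1.trans ?_
      have hνsplit : (D : ℝ) ^ (δ + β) = (D : ℝ) ^ (ν - 2) * (D : ℝ) ^ τ := by
        rw [← Real.rpow_add hx]; congr 1; rw [hδdef]; ring
      rw [hνsplit, neg_div, neg_le_neg_iff, le_div_iff₀ hTpos]
      have h0 := Real.rpow_nonneg hx.le (ν - 2)
      have e := mul_le_mul_of_nonneg_left hTτ (mul_nonneg hκ0.le h0)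
      linarith only [e]
    exact (Real.log_le_iff_le_exp (hd₁pos j₁)).mp h2
  have hnear2 : pdist ξ η (supNormalise (L.α j₁)) < ‖η‖ / (2 * roy_c2 ξ η ^ 2) :=
    lt_of_le_of_lt hsmall hE2
  -- the chart
  have hchart : ∀ j ∈ O, L.α j 0 ≠ 0 ∧ L.α j 2 ≠ 0 := by
    rw [hOdef] at hj₁O ⊢
    exact (L.cfg K hK).chart_of_mem_orb hη hj₁O hj₁near hnear2
  -- assemble
  rw [hY, hU] at hvanO
  refine ⟨j₀, hvanO, ?_, by rw [← hOdef]; exact hchart, j₁, by rw [← hOdef]; exact hj₁O, hj₁near, hsmall⟩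
  rw [← hOdef, ← hhO, ← hd, ← hΛ₂]
  exact hdist2

end Summit.Schanuel.Schanuel.Theorems.RoyLinks

end
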